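import Summits.ResolutionOfSingularities.ResolutionOfSingularities.Theorems.HomologicalConductorNoZenoSplitExcCount
import Literature.AlgebraicGeometry.Resolution.MinimalResolutionUnique
import HarnessLib

/-!
# Route `HomologicalConductor`, crux `NoZenoR` (stmt-ResolutionOfSingularities-19943): the split count does not depend
# on the choice of the minimal resolution (brick G0-count of `stub_L1wCore`)

`[OURS · L W4.4]` Cell res-hironaka, crux chain W4.4 (lead prover res-L0-w44-lead-1 gen 5).  The (L1-w) sandwich step
`stub_L1wCore` receives its two hypotheses through TWO existentially quantified minimal resolutions — the split count
`HasSplitExcCurveCountLE D N` (U8) names one, the sep-node sandwiching `IsSepX1Sandwiched I` (U8) names another.  This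
file transports the exceptional data along an isomorphism of `R`-schemes (in particular along the isomorphism between two
minimal resolutions, `Literature…IsMinimalResolution.nonempty_iso`, brick G0 p532206):

* `mem_excCurvePoints_comp_iff` / `image_excCurvePoints_comp` — for an isomorphism `e : X₁ ≅ X₂` the integral exceptional
  curves of `e.hom ≫ π` are carried by `e` onto those of `π` (heights for the specialisation preorder are preserved by
  the homeomorphism `e`);
* `splitWeight_comp` — the split weight of `η` for `e.hom ≫ π` is the split weight of `e η` for `π` (the residue fields are
  isomorphic over `κ(π (e η))`; `sepDegree_comp_ringEquiv` is the field-theoretic core: the degree of the separable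
  closure is invariant under an isomorphism of the top field);
* `splitExcCount_comp`, `finite_excCurvePoints_comp_iff` — hence `N^s(e.hom ≫ π) = N^s(π)`;
* `splitExcCount_le_of_isMinimalResolution` — **the consumer form**: `HasSplitExcCurveCountLE R N` gives, for EVERY minimal
  resolution `π` of `Spec R`, `(excCurvePoints π).Finite ∧ splitExcCount π ≤ N` (and the plain-count analogue
  `ncard_excCurvePoints_le_of_isMinimalResolution`).

Nothing here is a statement of the manuscript under review (Hironaka 2017); OURS; AI-written, weaker than expert review.
[cite: Lipman1969, §16 (16.1) (p. 231)]
-/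

noncomputable section

-- single-problem summit: the doubled namespace component `ResolutionOfSingularities` is forced
set_option linter.dupNamespace false

namespace Summit.ResolutionOfSingularities.ResolutionOfSingularities.Theorems.NoZeno.ExcCount

open CategoryTheory AlgebraicGeometry IsLocalRing
open Literature.AlgebraicGeometry.Resolution

/-! ## The field-theoretic core: the separable degree along a ring map is invariant under isomorphisms of the target -/

/-- The (junk-guarded) separable degree of a field homomorphism `φ : F →+* E`: `max 1 [ (separable closure of F in E) : F ]`
— `splitWeight π η` is this for `φ = π.residueFieldMap η`. [this work] -/
def sepDegree {F E : Type*} [Field F] [Field E] (φ : F →+* E) : ℕ :=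
  letI := φ.toAlgebra
  max 1 (Module.finrank F (separableClosure F E))

/-- `splitWeight` IS `sepDegree` of the residue field map (definitional). [this work] -/
theorem splitWeight_eq_sepDegree {R : Type} [CommRing R] {X : Scheme.{0}} (π : X ⟶ Spec (.of R)) (η : X) :
    splitWeight π η = sepDegree (π.residueFieldMap η).hom := rfl

/-- **The separable degree is invariant under an isomorphism of the top field**: for `φ : F →+* E` and a ring
isomorphism `ψ : E ≃+* E'`, `sepDegree (ψ ∘ φ) = sepDegree φ` (the `F`-algebra isomorphism `ψ` carries the separable
closure of `F` in `E` onto that in `E'`, Mathlib `separableClosure.algEquivOfAlgEquiv`). [this work] -/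
theorem sepDegree_comp_ringEquiv {F E E' : Type*} [Field F] [Field E] [Field E'] (φ : F →+* E) (ψ : E ≃+* E') :
    sepDegree (ψ.toRingHom.comp φ) = sepDegree φ := by
  letI : Algebra F E := φ.toAlgebra
  letI : Algebra F E' := (ψ.toRingHom.comp φ).toAlgebra
  -- `ψ` is an `F`-algebra isomorphism for these structures
  let ψₐ : E ≃ₐ[F] E' :=
    { ψ with
      commutes' := fun r => rfl }
  have h : Module.finrank F (separableClosure F E') = Module.finrank F (separableClosure F E) :=
    (separableClosure.algEquivOfAlgEquiv ψₐ).toLinearEquiv.finrank_eq.symm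
  unfold sepDegree
  exact congrArg (max 1) h

/-! ## Transport of the exceptional data along an isomorphism of `R`-schemes -/

section Transport

variable {R : Type} [CommRing R] [IsLocalRing R] {X₁ X₂ : Scheme.{0}} (e : X₁ ≅ X₂) (π : X₂ ⟶ Spec (.of R))

/-- The homeomorphism underlying an isomorphism of schemes preserves heights for the specialisation preorder.
[this work] -/
theorem height_homeoOfIso_apply (x : X₁) : Order.height (e.hom.base x) = Order.height x := by
  -- the order isomorphism induced by the homeomorphism `e`
  let f : X₁ ≃o X₂ :=
    { toEquiv := (Scheme.homeoOfIso e).toEquiv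
      map_rel_iff' := by
        intro a b
        change (Scheme.homeoOfIso e) b ⤳ (Scheme.homeoOfIso e) a ↔ b ⤳ a
        constructor
        · intro h
          have h' := h.map (Scheme.homeoOfIso e).symm.continuous
          simpa using h'
        · intro h
          exact h.map (Scheme.homeoOfIso e).continuous }
  exact Order.height_orderIso f x

/-- **Exceptional curves along an isomorphism**: `η` is an integral exceptional curve point of `e.hom ≫ π` iff `e η` is one
of `π`. [this work] -/
theorem mem_excCurvePoints_comp_iff (η : X₁) :
    η ∈ excCurvePoints (e.hom ≫ π) ↔ e.hom.base η ∈ excCurvePoints π := by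
  simp only [excCurvePoints, Set.mem_setOf_eq, Scheme.Hom.comp_base, TopCat.coe_comp, Function.comp_apply,
    height_homeoOfIso_apply]

/-- `e` maps the exceptional curve points of `e.hom ≫ π` bijectively onto those of `π`. [this work] -/
theorem bijOn_excCurvePoints_comp :
    Set.BijOn e.hom.base (excCurvePoints (e.hom ≫ π)) (excCurvePoints π) := by
  refine ⟨fun η hη => (mem_excCurvePoints_comp_iff e π η).mp hη,
    (Scheme.homeoOfIso e).injective.injOn, fun η₂ hη₂ => ?_⟩
  have hsurj : e.hom.base ((Scheme.homeoOfIso e).symm η₂) = η₂ := (Scheme.homeoOfIso e).apply_symm_apply η₂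
  refine ⟨(Scheme.homeoOfIso e).symm η₂, ?_, hsurj⟩
  rw [mem_excCurvePoints_comp_iff, hsurj]
  exact hη₂

/-- The image statement. [this work] -/
theorem image_excCurvePoints_comp : e.hom.base '' excCurvePoints (e.hom ≫ π) = excCurvePoints π :=
  (bijOn_excCurvePoints_comp e π).image_eq

/-- Finiteness of the exceptional curves is invariant. [this work] -/
theorem finite_excCurvePoints_comp_iff : (excCurvePoints (e.hom ≫ π)).Finite ↔ (excCurvePoints π).Finite := by
  rw [← image_excCurvePoints_comp e π]
  exact (Set.finite_image_iff (Scheme.homeoOfIso e).injective.injOn).symm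

/-- The plain count is invariant. [this work] -/
theorem ncard_excCurvePoints_comp : (excCurvePoints (e.hom ≫ π)).ncard = (excCurvePoints π).ncard := by
  rw [← image_excCurvePoints_comp e π]
  exact (Set.ncard_image_of_injective _
    (show Function.Injective e.hom.base from (Scheme.homeoOfIso e).injective)).symm

omit [IsLocalRing R] in
/-- **Split weights along an isomorphism**: the residue field of `η` on `X₁` and of `e η` on `X₂` are isomorphic over
`κ(π (e η))`, so the split weights agree. [this work] -/
theorem splitWeight_comp (η : X₁) : splitWeight (e.hom ≫ π) η = splitWeight π (e.hom.base η) := by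
  rw [splitWeight_eq_sepDegree, splitWeight_eq_sepDegree]
  have hcomp : ((e.hom ≫ π).residueFieldMap η).hom =
      (e.hom.residueFieldMap η).hom.comp (π.residueFieldMap (e.hom.base η)).hom := by
    rw [Scheme.residueFieldMap_comp]
    rfl
  rw [hcomp]
  -- `e.hom.residueFieldMap η` is an isomorphism of fields
  let ψ : X₂.residueField (e.hom.base η) ≃+* X₁.residueField η :=
    (asIso (e.hom.residueFieldMap η)).commRingCatIsoToRingEquiv
  have hψ : (e.hom.residueFieldMap η).hom = ψ.toRingHom := rfl
  rw [hψ]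
  exact sepDegree_comp_ringEquiv _ ψ

/-- **The split count is invariant**: `N^s(e.hom ≫ π) = N^s(π)`. [this work] -/
theorem splitExcCount_comp : splitExcCount (e.hom ≫ π) = splitExcCount π :=
  finsum_mem_eq_of_bijOn e.hom.base (bijOn_excCurvePoints_comp e π) (fun η _ => splitWeight_comp e π η)

end Transport

/-! ## The consumer form: the counts of ANY minimal resolution -/

/-- **`HasSplitExcCurveCountLE R N` bounds the split count of EVERY minimal resolution** (the two minimal resolutions are
isomorphic over `Spec R`, brick G0 `IsMinimalResolution.nonempty_iso`). [this work] -/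
theorem splitExcCount_le_of_isMinimalResolution {R : Type} [CommRing R] [IsLocalRing R] {N : ℕ}
    (h : HasSplitExcCurveCountLE R N) {X : Scheme.{0}} {π : X ⟶ Spec (.of R)} (hπ : IsMinimalResolution π) :
    (excCurvePoints π).Finite ∧ splitExcCount π ≤ N := by
  obtain ⟨X₀, π₀, h₀, hfin, hle⟩ := h
  obtain ⟨e, he⟩ := IsMinimalResolution.nonempty_iso h₀ hπ
  subst he
  exact ⟨(finite_excCurvePoints_comp_iff e π).mp hfin, (splitExcCount_comp e π) ▸ hle⟩

/-- The plain-count analogue for U7's `HasExcCurveCountLE`. [this work] -/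
theorem ncard_excCurvePoints_le_of_isMinimalResolution {R : Type} [CommRing R] [IsLocalRing R] {N : ℕ}
    (h : HasExcCurveCountLE R N) {X : Scheme.{0}} {π : X ⟶ Spec (.of R)} (hπ : IsMinimalResolution π) :
    (excCurvePoints π).Finite ∧ (excCurvePoints π).ncard ≤ N := by
  obtain ⟨X₀, π₀, h₀, hfin, hle⟩ := h
  obtain ⟨e, he⟩ := IsMinimalResolution.nonempty_iso h₀ hπ
  subst he
  exact ⟨(finite_excCurvePoints_comp_iff e π).mp hfin, (ncard_excCurvePoints_comp e π) ▸ hle⟩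

end Summit.ResolutionOfSingularities.ResolutionOfSingularities.Theorems.NoZeno.ExcCount

end
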